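import Summits.ABC.StewartYu.ArchG3StartDc
import HarnessLib

/-!
# Cell abc-stewartyu, rung A1.L (crux r2 `ArchCoreRat`), WP-L.A: the START in Δ-form in its GENERIC form — translated θ-box, VIRTUAL slab
# bound, generic monomial denominator, family invariant `Q` (the form the one-stage line at `S(θ)` instantiates; R32 (a)/(b), R34)

`Summits/ABC/StewartYu/ArchG3StartG.lean` — cell `abc-stewartyu` (HOME `run/shared/lean/pub/abc-stewartyu/`; seat lp-1 g8).  Theorems on
`ArchG3Setup`; no definition, no named fact, no numerics.  Sequel of `ArchG3StartD`/`ArchG3StartDc` (✓).  `start_deltaDc` still counts the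
slab classes with the θ-box bound `Θ = Σ sₖ·Aₖ` (`Aₖ ≥ |log θₖ|`) — at `S(θ)` that is `N`-inflated, and the class count `2⌈Θ/w⌉+1` enters
the Siegel count LINEARLY.  Print's classes are those of the functional `Lsum` measured VIRTUALLY: for the translated `𝔑`-family
`Lsum μ = (1/N)·Σⱼ ν(μ)ⱼ·log α°ⱼ` lies within `Θᵥ = Σⱼ σⱼ·|log α°ⱼ|` (`= nL/2` for `σⱼ = L/(2Aⱼ)`) of the centre `(1/N)Σⱼ N tⱼ log α°ⱼ`.  Hence
the generic form: a CENTRE `cΛ` and a BOUND `Θ` with `|Lsum μ − cΛ| ≤ Θ` on `𝔅` are data; the θ-box `|μₖ − τₖ| ≤ sₖ` is kept only for the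
relative box and the Δ-weight sizes (logarithmic costs).

* `exists_slab_subfamily_of_bound` — classes of `Lsum μ − cΛ` of width `w`, `#𝔅 ≤ (2⌈Θ/w⌉₊ + 1)·#𝔏`;
* `start_deltaG` — `start_deltaDc` with `(cΛ, Θ, hΘ)` in place of `(A, hA)` and `hcount : 2·#E·(2⌈Θ/w⌉₊+1) ≤ (L₀+1)·#𝔅`;
* `archLevelStateQ_zeroG` — the level-`0` `ArchLevelStateQ Q …` from it and the record's `hQ0`.

WHAT THIS IS NOT: the count / centre / sizes (record, seat p1; `SatBoxTranslate`, seat p4; `ArchG3SatData`, seat p5); no crux moves.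

References: Yu. V. Nesterenko, LNM 1819 (2003) §3.3 (3.12)–(3.13) Prop. 3.4 p. 66–69, §3.5 (3.22)–(3.30) Prop. 3.9 p. 71–76, (3.41)–(3.44)
p. 76–78, §4 (4.6) p. 80–81 [Nesterenko2003]; E. M. Matveev, Izv. Math. 64 (2000) §3 [Matveev2000].
-/

noncomputable section

open Finset Polynomial
open Literature.NumberTheory.Transcendental
open Literature.NumberTheory.Transcendental.CW77.Setup (Tau tauNorm tauSet)
open Literature.NumberTheory.DiophantineGeometry.Dioph (exists_slab_class)
open Summit.ABC.StewartYu.ArchSupply (scaledFeldR)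
open scoped Nat

namespace Summit.ABC.StewartYu

namespace ArchG3Setup

variable (S : ArchG3Setup)

/-! ### The slab classes from a virtual bound -/

/-- **A slab sub-family from a bound on the functional**: if `|Lsum μ − cΛ| ≤ Θ` on `𝔅` and `w > 0`, there is `𝔏 ⊆ 𝔅` with all
`Lsum μ − cΛ`, `μ ∈ 𝔏`, in one half-open interval of length `w` and `#𝔅 ≤ (2⌈Θ/w⌉₊ + 1)·#𝔏`.
[cite: Nesterenko2003, §3.3 (3.12)–(3.13), Prop. 3.4, p. 66] [cite: Matveev2000, §3] -/
theorem exists_slab_subfamily_of_bound {𝔅 : Finset (Fin S.n → ℤ)} {cΛ Θ : ℝ} (hΘ : ∀ μ ∈ 𝔅, |S.Lsum μ - cΛ| ≤ Θ) {w : ℝ}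
    (hw : 0 < w) :
    ∃ 𝔏 : Finset (Fin S.n → ℤ), 𝔏 ⊆ 𝔅 ∧ (∃ c₀ : ℝ, ∀ lam ∈ 𝔏, c₀ ≤ S.Lsum lam - cΛ ∧ S.Lsum lam - cΛ < c₀ + w) ∧
      𝔅.card ≤ (2 * ⌈Θ / w⌉₊ + 1) * 𝔏.card := by
  classical
  obtain ⟨c₀, hc₀⟩ := exists_slab_class 𝔅 (fun lam => S.Lsum lam - cΛ) hw hΘ
  exact ⟨𝔅.filter fun lam => c₀ ≤ S.Lsum lam - cΛ ∧ S.Lsum lam - cΛ < c₀ + w, filter_subset _ _,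
    ⟨c₀, fun lam hl => (mem_filter.mp hl).2⟩, hc₀⟩

/-- **THE START in Δ-form, GENERIC form**: candidate set in a translated θ-box `|μⱼ − τⱼ| ≤ sⱼ` (relative box `[τ − s − λ♭, … + 2s] ∋ 0`,
Δ-weight sizes on the doubled box), slab classes of `Lsum μ − cΛ` from a VIRTUAL bound `Θ`, generic monomial denominator `Dm₀` for
differences of members, slab-charged coefficient size `DΔ·M₀·Dm₀·e^{wX₀} ≤ Amax`.
[cite: Nesterenko2003, §3.5 (3.22)–(3.30), Prop. 3.9, §3.4 (3.41)–(3.44), §4 (4.6), p. 71–81, 105–107] -/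
theorem start_deltaG (s : Fin S.n → ℕ) (τ : Fin S.n → ℤ) {𝔅 : Finset (Fin S.n → ℤ)}
    (h𝔅 : ∀ μ ∈ 𝔅, ∀ j, |μ j - τ j| ≤ (s j : ℤ)) {cΛ Θ : ℝ} (hΘ : ∀ μ ∈ 𝔅, |S.Lsum μ - cΛ| ≤ Θ) (L₀ X₀ T₀ : ℕ) (hT₀ : 1 ≤ T₀) (R₀ : ℕ → ℚ[X]) {w : ℝ} (hw : 0 < w) {c : ℤ} (hc : c ≠ 0) {e : Fin S.n → ℤ} (he : e S.j₀ = 0)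
    (E : Finset (ℤ × Tau S.n)) (hEdef : E = Icc (-(X₀ : ℤ)) X₀ ×ˢ tauSetR S.n S.j₀ T₀)
    (hcount : 2 * E.card * (2 * ⌈Θ / w⌉₊ + 1) ≤ (L₀ + 1) * 𝔅.card)
    (den₀ : ℤ × Tau S.n → ℕ) (hden₀ : ∀ q ∈ E, 1 ≤ den₀ q) (M₀ : ℤ × Tau S.n → ℤ)
    (hR : ∀ q ∈ E, ∀ ℓ₀ ≤ L₀, ∃ z₀ : ℤ, (den₀ q : ℚ) * (hasseDeriv q.2.1 (R₀ ℓ₀)).eval (q.1 : ℚ) = z₀ ∧ |z₀| ≤ M₀ q)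
    {DΔ : ℝ} (hDΔ : ∀ w' : Fin S.n → ℤ, (∀ j, |w' j| ≤ ((2 * s j : ℕ) : ℤ)) → ∀ q ∈ E,
      |((∏ k, Ring.multichoose (S.yΔ c e w' k) (q.2.2 k) : ℤ) : ℝ)| ≤ DΔ)
    (Dm₀ : ℤ → ℕ) (hDm₀ : ∀ x, 1 ≤ Dm₀ x)
    (hmon₀ : ∀ x : ℤ, |x| ≤ (X₀ : ℤ) → ∀ μ ∈ 𝔅, ∀ μ' ∈ 𝔅, ∃ z₂ : ℤ, (Dm₀ x : ℚ) * ∏ j, S.α j ^ ((μ j - μ' j) * x) = z₂)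
    {Amax : ℝ} (hAmax : 1 ≤ Amax)
    (hAm : ∀ q ∈ E, DΔ * (M₀ q : ℝ) * (Dm₀ q.1 : ℝ) * Real.exp (w * X₀) ≤ Amax) :
    ∃ (𝔏 : Finset (Fin S.n → ℤ)) (lamb : Fin S.n → ℤ) (pv : ℕ × (Fin S.n → ℤ) → ℤ),
      𝔏 ⊆ 𝔅 ∧ lamb ∈ 𝔏 ∧
      S.ArchLvInv (fun i => R₀ i.1) (S.unkA L₀ 𝔏) (fun i => i.2 - lamb) pv (fun j => τ j - (s j : ℤ) - lamb j) (fun j => 2 * s j)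
        ⌈((S.unkA L₀ 𝔏).card : ℝ) * Amax⌉ w 0 c e {x : ℤ | |x| ≤ (X₀ : ℤ)} T₀ := by
  classical
  -- Step 1: the slab class
  obtain ⟨𝔏, h𝔏𝔅, ⟨c₀, hc₀⟩, hcard𝔏⟩ := S.exists_slab_subfamily_of_bound hΘ hw
  set K : ℕ := 2 * ⌈Θ / w⌉₊ + 1 with hK
  have hK0 : 0 < K := by omega
  have hE : E.Nonempty := by
    refine ⟨((0 : ℤ), ((0 : ℕ), fun _ => (0 : ℕ))), ?_⟩
    rw [hEdef, mem_product, mem_Icc, mem_tauSetR]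
    refine ⟨⟨by omega, by omega⟩, ?_, rfl⟩
    unfold tauNorm; simp; omega
  have h𝔏ne : 𝔏.Nonempty := by
    rw [← Finset.card_pos]
    by_contra h0
    push Not at h0
    have : 𝔏.card = 0 := by omega
    rw [this, mul_zero] at hcard𝔏
    have hEpos : 0 < E.card := Finset.card_pos.mpr hE
    have h1 : 2 * E.card * K ≤ (L₀ + 1) * 0 := hcount.trans (Nat.mul_le_mul_left _ hcard𝔏)
    have : 0 < 2 * E.card * K := by positivity
    omega
  obtain ⟨lamb, hlamb⟩ := h𝔏ne
  -- Step 2: re-basing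
  set U := S.unkA L₀ 𝔏 with hU
  set v : ℕ × (Fin S.n → ℤ) → Fin S.n → ℤ := fun i => i.2 - lamb with hv
  have hbox𝔏 : ∀ lam ∈ 𝔏, ∀ j, |lam j - τ j| ≤ (s j : ℤ) := fun lam hl => h𝔅 lam (h𝔏𝔅 hl)
  have hvbox : ∀ i ∈ U, ∀ j, |v i j| ≤ ((2 * s j : ℕ) : ℤ) := by
    intro i hi j
    have h1 := hbox𝔏 i.2 (S.mem_unkA.mp hi).2 j
    have h2 := hbox𝔏 lamb hlamb j
    simp only [hv, Pi.sub_apply]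
    rw [abs_le] at h1 h2 ⊢
    push_cast
    constructor <;> omega
  -- the slab of the differences: `|Lsum (v i)| ≤ w`
  have hvslab : ∀ i ∈ U, |S.Lsum (v i)| ≤ w := by
    intro i hi
    have h1 := hc₀ i.2 (S.mem_unkA.mp hi).2
    have h2 := hc₀ lamb hlamb
    have e1 : S.Lsum (v i) = (S.Lsum i.2 - cΛ) - (S.Lsum lamb - cΛ) := by
      simp only [hv]; rw [← S.sub_Lsum]; ring
    rw [e1, abs_le]
    constructor <;> linarith [h1.1, h1.2, h2.1, h2.2]
  -- the count
  have hcardU : 2 * E.card ≤ U.card := by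
    rw [hU, S.card_unkA]
    have h1 : 2 * E.card * K ≤ ((L₀ + 1) * 𝔏.card) * K := by
      calc 2 * E.card * K ≤ (L₀ + 1) * 𝔅.card := hcount
        _ ≤ (L₀ + 1) * (K * 𝔏.card) := Nat.mul_le_mul_left _ hcard𝔏
        _ = ((L₀ + 1) * 𝔏.card) * K := by ring
    exact Nat.le_of_mul_le_mul_right h1 hK0
  -- Step 3: Siegel on the Δ-equations (coefficients `qTermΔ`, denominators `den₀ · Dm₀`)
  set R : ℕ × (Fin S.n → ℤ) → ℚ[X] := fun i => R₀ i.1 with hRdef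
  set Dq : ℤ × Tau S.n → ℕ := fun q => den₀ q * Dm₀ q.1 with hDq
  have hDq0 : ∀ q ∈ E, 0 < Dq q := fun q hq => Nat.mul_pos (hden₀ q hq) (hDm₀ q.1)
  have hxE : ∀ q ∈ E, |q.1| ≤ (X₀ : ℤ) := by
    intro q hq
    rw [hEdef, mem_product, mem_Icc] at hq
    rw [abs_le]; exact ⟨hq.1.1, hq.1.2⟩
  -- the monomial of `v u` at `x` is cleared by `Dm₀ x`
  have hmonv : ∀ q ∈ E, ∀ u ∈ U, ∃ z₂ : ℤ, (Dm₀ q.1 : ℚ) * ∏ j, S.α j ^ (v u j * q.1) = z₂ := by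
    intro q hq u hu
    obtain ⟨z₂, hz₂⟩ := hmon₀ q.1 (hxE q hq) u.2 (h𝔏𝔅 (S.mem_unkA.mp hu).2) lamb (h𝔏𝔅 hlamb)
    refine ⟨z₂, ?_⟩
    rw [← hz₂]
    simp only [hv, Pi.sub_apply]
  have hentry : ∀ q ∈ E, ∀ u ∈ U, ∃ z : ℤ, (Dq q : ℚ) * S.qTermΔ R v c e q.2.2 q.2.1 q.1 u = z ∧ |(z : ℝ)| ≤ Amax := by
    intro q hq u hu
    obtain ⟨z₀, hz₀, hz₀le⟩ := hR q hq u.1 (S.mem_unkA.mp hu).1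
    obtain ⟨z₂, hz₂⟩ := hmonv q hq u hu
    obtain ⟨z, hz, hzabs⟩ := S.exists_int_clear_mul_qTermΔ_of_clear R v c e q.2.2 q.2.1 q.1 u hz₀ hz₂
    refine ⟨z, hz, ?_⟩
    -- sizes: `|∏ multichoose| ≤ DΔ`, `|z₀| ≤ M₀`, `|z₂| = Dm₀ · e^{x · Lsum (v u)} ≤ Dm₀ · e^{w X₀}`
    have h1 : |(z : ℝ)| = |∏ k, ((Ring.multichoose (S.yΔ c e (v u) k) (q.2.2 k) : ℤ) : ℝ)| * |(z₀ : ℝ)| * |(z₂ : ℝ)| := by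
      have := congrArg (fun t : ℤ => (t : ℝ)) hzabs
      push_cast at this
      exact this
    have h3 : |∏ k, ((Ring.multichoose (S.yΔ c e (v u) k) (q.2.2 k) : ℤ) : ℝ)| ≤ DΔ := by
      have := hDΔ (v u) (hvbox u hu) q hq
      push_cast at this
      exact this
    have h2 : |(z₀ : ℝ)| ≤ M₀ q := by
      have := (Int.cast_le (R := ℝ)).mpr hz₀le
      push_cast at this
      exact this
    have hDΔ0 : 0 ≤ DΔ := (abs_nonneg _).trans h3
    have hM0 : (0 : ℝ) ≤ M₀ q := (abs_nonneg _).trans h2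
    have h4 : |(z₂ : ℝ)| ≤ (Dm₀ q.1 : ℝ) * Real.exp (w * X₀) := by
      have e2 : (z₂ : ℝ) = (Dm₀ q.1 : ℝ) * Real.exp ((q.1 : ℝ) * S.Lsum (v u)) := by
        rw [S.exp_intCast_mul_Lsum]
        have := congrArg (fun t : ℚ => (t : ℝ)) hz₂
        push_cast at this ⊢
        rw [← this]
      rw [e2, abs_mul, abs_of_nonneg (by positivity : (0 : ℝ) ≤ (Dm₀ q.1 : ℝ)), Real.abs_exp]
      refine mul_le_mul_of_nonneg_left (Real.exp_le_exp.mpr ?_) (by positivity)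
      have hx : |(q.1 : ℝ)| ≤ X₀ := by exact_mod_cast hxE q hq
      calc (q.1 : ℝ) * S.Lsum (v u) ≤ |(q.1 : ℝ) * S.Lsum (v u)| := le_abs_self _
        _ = |(q.1 : ℝ)| * |S.Lsum (v u)| := abs_mul _ _
        _ ≤ X₀ * w := mul_le_mul hx (hvslab u hu) (abs_nonneg _) (by positivity)
        _ = w * X₀ := mul_comm _ _
    rw [h1]
    calc |∏ k, ((Ring.multichoose (S.yΔ c e (v u) k) (q.2.2 k) : ℤ) : ℝ)| * |(z₀ : ℝ)| * |(z₂ : ℝ)|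
        ≤ DΔ * (M₀ q : ℝ) * ((Dm₀ q.1 : ℝ) * Real.exp (w * X₀)) :=
          mul_le_mul (mul_le_mul h3 h2 (abs_nonneg _) hDΔ0) h4 (abs_nonneg _) (mul_nonneg hDΔ0 hM0)
      _ = DΔ * (M₀ q : ℝ) * (Dm₀ q.1 : ℝ) * Real.exp (w * X₀) := by ring
      _ ≤ Amax := hAm q hq
  have hint : ∀ q ∈ E, ∀ u ∈ U, ∃ z : ℤ, (Dq q : ℚ) * S.qTermΔ R v c e q.2.2 q.2.1 q.1 u = z := fun q hq u hu => by
    obtain ⟨z, hz, _⟩ := hentry q hq u hu; exact ⟨z, hz⟩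
  have hAbd : ∀ q ∈ E, ∀ u ∈ U, |((Dq q : ℚ) * S.qTermΔ R v c e q.2.2 q.2.1 q.1 u : ℚ)| ≤ (Amax : ℝ) := by
    intro q hq u hu
    obtain ⟨z, hz, hzle⟩ := hentry q hq u hu
    rw [hz]
    push_cast
    exact hzle
  obtain ⟨pv, hsupp, hne, hbd, hsol⟩ := SiegelFinset.exists_int_vec_of_finset U E hE hcardU
    (fun q u => S.qTermΔ R v c e q.2.2 q.2.1 q.1 u) Dq hDq0 hint hAmax hAbd
  -- Step 4: the level-0 invariant
  have hnz : ∃ i ∈ U, pv i ≠ 0 := by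
    obtain ⟨u, hu⟩ := hne
    exact ⟨u, hsupp u hu, hu⟩
  have hlo : ∀ j, (fun j => τ j - (s j : ℤ) - lamb j) j ≤ 0 ∧ 0 ≤ (fun j => τ j - (s j : ℤ) - lamb j) j + ((2 * s j : ℕ) : ℤ) := by
    intro j
    have h2 := hbox𝔏 lamb hlamb j
    rw [abs_le] at h2
    push_cast
    constructor <;> omega
  have hboxv : ∀ i ∈ U, ∀ j,
      (fun j => τ j - (s j : ℤ) - lamb j) j ≤ v i j ∧ v i j ≤ (fun j => τ j - (s j : ℤ) - lamb j) j + ((2 * s j : ℕ) : ℤ) := by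
    intro i hi j
    have h1 := hbox𝔏 i.2 (S.mem_unkA.mp hi).2 j
    rw [abs_le] at h1
    simp only [hv, Pi.sub_apply]
    push_cast
    constructor <;> omega
  have hslab : ∀ i ∈ U, |S.Lsum (v i) - 0| ≤ w := fun i hi => by rw [sub_zero]; exact hvslab i hi
  have hvan : ∀ x : ℤ, x ∈ {x : ℤ | |x| ≤ (X₀ : ℤ)} → ∀ (a : ℕ) (μ : Fin S.n → ℕ), a + ∑ k, μ k < T₀ →
      S.archφ R v U (S.pvΔ v pv c e μ) ((a, 0) : Tau S.n) x = 0 := by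
    intro x hx a μ haμ
    by_cases hμ : 0 < μ S.j₀
    · exact S.archφ_pvΔ_eq_zero_of_pivot_pos R v U pv c he hμ _ x
    · have hμ0 : μ S.j₀ = 0 := by omega
      have hq : (x, ((a, μ) : Tau S.n)) ∈ E := by
        rw [hEdef, mem_product, mem_Icc, mem_tauSetR]
        have hx' : |x| ≤ (X₀ : ℤ) := hx
        rw [abs_le] at hx'
        refine ⟨⟨hx'.1, hx'.2⟩, ?_, hμ0⟩
        unfold tauNorm; simpa using haμ
      rw [S.archφ_pvΔ_zero_eq_sum R v U pv c e μ a x]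
      have h := hsol (x, ((a, μ) : Tau S.n)) hq
      simp only at h
      exact h
  exact ⟨𝔏, lamb, pv, h𝔏𝔅, hlamb,
    { nonzero := hnz
      bound := fun i _ => hbd i
      lo_le := hlo
      box := hboxv
      slab := hslab
      c_ne := hc
      vanish := hvan }⟩

/-- **The level-`0` STATE WITH `Q`, generic START** (as `archLevelStateQ_zeroD` over `start_deltaG`): if the record's `Q` holds at level `0` for every
family of differences `i.2 − λ♭` over a sub-class `𝔏 ⊆ 𝔅` and a member `λ♭ ∈ 𝔏` (e.g. the virtual box of differences of members of `𝔅`),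
then `start_deltaD` gives `ArchLevelStateQ Q H Ŝ s U pv P wl γb cl el 0 X₀ T₀` with `U = unkA L₀ 𝔏`.
[cite: Nesterenko2003, §4 (4.6) at s = 0, p. 80–81] -/
theorem archLevelStateQ_zeroG {Q : Finset (ℕ × (Fin S.n → ℤ)) → ((ℕ × (Fin S.n → ℤ)) → Fin S.n → ℤ) → ℕ → Prop}
    (s : Fin S.n → ℕ) (τ : Fin S.n → ℤ) {𝔅 : Finset (Fin S.n → ℤ)}
    (h𝔅 : ∀ μ ∈ 𝔅, ∀ j, |μ j - τ j| ≤ (s j : ℤ)) {cΛ Θ : ℝ} (hΘ : ∀ μ ∈ 𝔅, |S.Lsum μ - cΛ| ≤ Θ) (H Sh L₀ X₀ T₀ : ℕ) (hT₀ : 1 ≤ T₀)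
    (hQ0 : ∀ 𝔏 : Finset (Fin S.n → ℤ), 𝔏 ⊆ 𝔅 → ∀ lamb : Fin S.n → ℤ, lamb ∈ 𝔏 → Q (S.unkA L₀ 𝔏) (fun i => i.2 - lamb) 0)
    (wl γb : ℕ → ℝ) (hw : 0 < wl 0) (hγb : 0 ≤ γb 0)
    (cl : ℕ → ℤ) (el : ℕ → Fin S.n → ℤ) (hc : cl 0 ≠ 0) (he : el 0 S.j₀ = 0)
    (E : Finset (ℤ × Tau S.n)) (hEdef : E = Icc (-(X₀ : ℤ)) X₀ ×ˢ tauSetR S.n S.j₀ T₀)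
    (hcount : 2 * E.card * (2 * ⌈Θ / wl 0⌉₊ + 1) ≤ (L₀ + 1) * 𝔅.card)
    (den₀ : ℤ × Tau S.n → ℕ) (hden₀ : ∀ q ∈ E, 1 ≤ den₀ q) (M₀ : ℤ × Tau S.n → ℤ)
    (hR : ∀ q ∈ E, ∀ ℓ₀ ≤ L₀, ∃ z₀ : ℤ,
      (den₀ q : ℚ) * (hasseDeriv q.2.1 (scaledFeldR ℓ₀ H (Sh - 0))).eval (q.1 : ℚ) = z₀ ∧ |z₀| ≤ M₀ q)
    {DΔ : ℝ} (hDΔ : ∀ w' : Fin S.n → ℤ, (∀ j, |w' j| ≤ ((2 * s j : ℕ) : ℤ)) → ∀ q ∈ E,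
      |((∏ k, Ring.multichoose (S.yΔ (cl 0) (el 0) w' k) (q.2.2 k) : ℤ) : ℝ)| ≤ DΔ)
    (Dm₀ : ℤ → ℕ) (hDm₀ : ∀ x, 1 ≤ Dm₀ x)
    (hmon₀ : ∀ x : ℤ, |x| ≤ (X₀ : ℤ) → ∀ μ ∈ 𝔅, ∀ μ' ∈ 𝔅, ∃ z₂ : ℤ, (Dm₀ x : ℚ) * ∏ j, S.α j ^ ((μ j - μ' j) * x) = z₂)
    {Amax : ℝ} (hAmax : 1 ≤ Amax)
    (hAm : ∀ q ∈ E, DΔ * (M₀ q : ℝ) * (Dm₀ q.1 : ℝ) * Real.exp (wl 0 * X₀) ≤ Amax) :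
    ∃ (𝔏 : Finset (Fin S.n → ℤ)) (pv : ℕ × (Fin S.n → ℤ) → ℤ), 𝔏 ⊆ 𝔅 ∧
      S.ArchLevelStateQ Q H Sh s (S.unkA L₀ 𝔏) pv ⌈((S.unkA L₀ 𝔏).card : ℝ) * Amax⌉ wl γb cl el 0 X₀ T₀ := by
  obtain ⟨𝔏, lamb, pv, h𝔏𝔅, hlamb, h⟩ := S.start_deltaG s τ h𝔅 hΘ L₀ X₀ T₀ hT₀ (fun ℓ₀ => scaledFeldR ℓ₀ H (Sh - 0)) hw hc he E hEdef
    hcount den₀ hden₀ M₀ hR hDΔ Dm₀ hDm₀ hmon₀ hAmax hAm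
  refine ⟨𝔏, pv, h𝔏𝔅, S.unkA L₀ 𝔏, fun i => i.2 - lamb, fun j => τ j - (s j : ℤ) - lamb j, 0, subset_refl _, ?_,
    by simpa using hγb, h,
    hQ0 𝔏 h𝔏𝔅 lamb hlamb⟩
  intro i _ i' _
  exact sub_left_inj

end ArchG3Setup

end Summit.ABC.StewartYu

end
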